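import Summits.BirchSwinnertonDyer.Rank1Residual.WAll.TargetCMTwoRamifiedFamilies
import HarnessLib
import HarnessLib.Audit.Tags

/-!
# Rung W-ALL of ladder BSD (D-0120) — the ramified slice of row 12₂ cut ONCE, flag-free: ON / OFF the
# PROVED Tian–Yuan–Zhang families (cell `bsd-print-cf2`, seat p1; the two-way cut route `PrintCf2` splits
# its deciding crux `RamifiedTwoRankOneOfFacts` (stmt-BirchSwinnertonDyer-20362) along — PLAN.md v1 §2 p1)

HONEST FRAMING (cell `bsd-print-cf2`, run/shared/lean/pub/bsd-print-cf2/): STATEMENTS AND BOOKKEEPING ONLY —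
nothing asserted, nothing booked, no named fact, no published theorem restated. `WAll/TargetCMTwoRamifiedFamilies.lean`
(p533515) cuts `WAllCornerFTwoRamified` four ways (TYZProved / TYZUPlus / TYZAtlasFJ / OffTYZ). The route's
crux bundle `𝔅_ram` deliberately EXCLUDES the ∃-fact `tyz_genusPointData` (LITERAL risk) and the odd-case
Monsky fact, so the only cut the route can glue INSIDE `𝔅_ram` is the TWO-WAY one: ON the flag-free families
(`CongruentTYZProvedFamily`: LLT ∨ T5 ∨ T7 ∨ M35 ∨ TYZρ — closed modulo facts ⊂ `𝔅_ram` by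
`PrintCf2.wAllCornerFTwoRamifiedTYZProved_of_facts`) versus OFF them. This file names the OFF part,
`WAllCornerFTwoRamifiedOffTYZProved` — the RESIDUAL OF THE FLAG-FREE p1 ROAD, leaf-verbatim consumable as
the route's residual crux (bsd-wall TYPING-CHECKLIST T7) — and proves the glue (excluded middle only):
`wAllCornerFTwoRamified_iff_tyzProved_offTYZProved` (EXACT), and that the U⁺-road / FJ-atlas leaves and the
four-way residual `WAllCornerFTwoRamifiedOffTYZ` are exactly a cut of this residual
(`wAllCornerFTwoRamifiedOffTYZProved_iff_uPlus_atlasFJ_offTYZ`), so the LITERAL families (binder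
`tyz_genusPointData`) are ATTACKED SUB-SLICES of the flag-free residual, by name.

References: `WAll/TargetCMTwoRamifiedFamilies.lean` (p533515), `WAll/TargetCMTwoSlices.lean` (p532371),
route file `Summits/BirchSwinnertonDyer/BirchSwinnertonDyer/Theses/PrintCf2.lean` (item stmt-BirchSwinnertonDyer-20362),
HOME/PLAN.md v1 §2 (p1: LAYER-2 split `RamifiedTYZFamiliesOfFacts` + `RamifiedOffTYZOfFacts`). [cite: Miller2011LMS, §1 and
Def. 1.1] (the currency `BSD(E,p)`).
-/

noncomputable section

open scoped Classical

open WeierstrassCurve Literature.NumberTheory.EllipticCurves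
  Literature.NumberTheory.EllipticCurves.Rank1Residual
open Summit.BirchSwinnertonDyer.Rank1Residual

set_option autoImplicit false

namespace Summit.BirchSwinnertonDyer

/-! ### §1. The flag-free residual of the p1 road, by name -/

/-- **Ramified slice OFF THE PROVED TYZ FAMILIES (OPEN) — the residual of the FLAG-FREE p1 road.** CM,
`ord_{s=1} L(E,s) = 1`, `2 ∣ d_K`, and `W` is a `ℚ`-model of NO member of `CongruentTYZProvedFamily` (LLT ∨ T5 ∨
T7 ∨ M35 ∨ TYZρ) ⇒ `BSD(E,2)`. It still CONTAINS the U⁺-road families (`CongruentTYZUPlusFamily`: Tian 2014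
class 6, the ρ-free TYZ genus class, the `ω = 3` atlas) and the FJ atlas — closed in the tree only modulo the
∃-fact `tyz_genusPointData` resp. the odd-case Monsky fact, both outside the route's bundle `𝔅_ram` — and,
beyond them, every `j = 1728` curve of analytic rank one that is no `E_m` in the families, every `j = 287496`
and every `K = ℚ(√−2)` (`j = 8000`) curve. No theorem in print. [folklore] -/
@[conjecture] def WAllCornerFTwoRamifiedOffTYZProved : Prop :=
  ∀ (W : WeierstrassCurve ℚ) [W.IsElliptic] [W.IsGloballyMinimal],
    W.HasCM → W.analyticRank = 1 → CMRamified W 2 → ¬ CongruentTYZProvedFamily W → BSDp W 2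

/-! ### §2. Glue (excluded middle on membership only) -/

/-- **The ramified slice ⟺ ON the proved TYZ families ∧ OFF them** (EXACT; pure logic) — the two-way cut the
route `PrintCf2` can glue inside its flag-free bundle. [folklore] -/
theorem wAllCornerFTwoRamified_iff_tyzProved_offTYZProved :
    WAllCornerFTwoRamified ↔ WAllCornerFTwoRamifiedTYZProved ∧ WAllCornerFTwoRamifiedOffTYZProved := by
  constructor
  · intro h
    exact ⟨fun W _ _ hcm hr1 hram _ ↦ h W hcm hr1 hram, fun W _ _ hcm hr1 hram _ ↦ h W hcm hr1 hram⟩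
  · rintro ⟨hP, hO⟩ W _ _ hcm hr1 hram
    by_cases h1 : CongruentTYZProvedFamily W
    · exact hP W hcm hr1 hram h1
    · exact hO W hcm hr1 hram h1

/-- The ramified slice from its two flag-free parts. [folklore] -/
theorem wAllCornerFTwoRamified_of_tyzProved_of_offTYZProved (hP : WAllCornerFTwoRamifiedTYZProved)
    (hO : WAllCornerFTwoRamifiedOffTYZProved) : WAllCornerFTwoRamified :=
  wAllCornerFTwoRamified_iff_tyzProved_offTYZProved.2 ⟨hP, hO⟩

/-- **The flag-free residual ⟺ (U⁺-road leaf off the proved families) ∧ (FJ-atlas leaf off the proved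
families) ∧ the four-way residual** — and since the U⁺ / FJ leaves of `WAll/TargetCMTwoRamifiedFamilies.lean`
do not ask for non-membership in the proved families, they IMPLY the first two conjuncts: the LITERAL families
are sub-slices of this residual. Stated as the exact iff with the restricted leaves spelled out. [folklore] -/
theorem wAllCornerFTwoRamifiedOffTYZProved_iff_uPlus_atlasFJ_offTYZ :
    WAllCornerFTwoRamifiedOffTYZProved ↔
      (∀ (W : WeierstrassCurve ℚ) [W.IsElliptic] [W.IsGloballyMinimal],
          W.HasCM → W.analyticRank = 1 → CMRamified W 2 → ¬ CongruentTYZProvedFamily W →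
            CongruentTYZUPlusFamily W → BSDp W 2) ∧
      (∀ (W : WeierstrassCurve ℚ) [W.IsElliptic] [W.IsGloballyMinimal],
          W.HasCM → W.analyticRank = 1 → CMRamified W 2 → ¬ CongruentTYZProvedFamily W →
            CongruentTYZAtlasFJFamily W → BSDp W 2) ∧
      WAllCornerFTwoRamifiedOffTYZ := by
  constructor
  · intro h
    exact ⟨fun W _ _ hcm hr1 hram hn _ ↦ h W hcm hr1 hram hn, fun W _ _ hcm hr1 hram hn _ ↦ h W hcm hr1 hram hn,
      fun W _ _ hcm hr1 hram hn _ _ ↦ h W hcm hr1 hram hn⟩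
  · rintro ⟨hU, hF, hO⟩ W _ _ hcm hr1 hram hn
    by_cases h2 : CongruentTYZUPlusFamily W
    · exact hU W hcm hr1 hram hn h2
    · by_cases h3 : CongruentTYZAtlasFJFamily W
      · exact hF W hcm hr1 hram hn h3
      · exact hO W hcm hr1 hram hn h2 h3

/-- **The LITERAL families are attacked sub-slices of the flag-free residual**: the U⁺-road leaf, the FJ-atlas
leaf and the four-way residual together give `WAllCornerFTwoRamifiedOffTYZProved`. [folklore] -/
theorem wAllCornerFTwoRamifiedOffTYZProved_of_uPlus_of_atlasFJ_of_offTYZ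
    (hU : WAllCornerFTwoRamifiedTYZUPlus) (hF : WAllCornerFTwoRamifiedTYZAtlasFJ)
    (hO : WAllCornerFTwoRamifiedOffTYZ) : WAllCornerFTwoRamifiedOffTYZProved :=
  wAllCornerFTwoRamifiedOffTYZProved_iff_uPlus_atlasFJ_offTYZ.2
    ⟨fun W _ _ hcm hr1 hram _ hm ↦ hU W hcm hr1 hram hm, fun W _ _ hcm hr1 hram _ hm ↦ hF W hcm hr1 hram hm, hO⟩

/-- Conversely the flag-free residual restricts to the four-way residual. [folklore] -/
theorem wAllCornerFTwoRamifiedOffTYZ_of_offTYZProved (h : WAllCornerFTwoRamifiedOffTYZProved) :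
    WAllCornerFTwoRamifiedOffTYZ :=
  (wAllCornerFTwoRamifiedOffTYZProved_iff_uPlus_atlasFJ_offTYZ.1 h).2.2

/-- … and follows from the ramified slice, from row 12₂, and from `WAll`. [folklore] -/
theorem wAllCornerFTwoRamifiedOffTYZProved_of_wAllCornerFTwoRamified (h : WAllCornerFTwoRamified) :
    WAllCornerFTwoRamifiedOffTYZProved :=
  (wAllCornerFTwoRamified_iff_tyzProved_offTYZProved.1 h).2

/-- Row 12₂ restricts to the flag-free residual. [folklore] -/
theorem wAllCornerFTwoRamifiedOffTYZProved_of_wAllCornerFTwo (h : WAllCornerFTwo) :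
    WAllCornerFTwoRamifiedOffTYZProved :=
  wAllCornerFTwoRamifiedOffTYZProved_of_wAllCornerFTwoRamified (wAllCornerFTwo_iff_slices.1 h).2.2.1

/-- **Row 12₂ with the proved TYZ families carved out (flag-free cut)**: `WAllCornerFTwo` ⟺ split-good ∧
split-bad ∧ (TYZProved ∧ OffTYZProved) ∧ inert-good ∧ inert-bad. [folklore] -/
theorem wAllCornerFTwo_iff_slices_tyzProved :
    WAllCornerFTwo ↔ WAllCornerFTwoSplitGood ∧ WAllCornerFTwoSplitBad ∧
      (WAllCornerFTwoRamifiedTYZProved ∧ WAllCornerFTwoRamifiedOffTYZProved) ∧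
      WAllCornerFTwoInertGood ∧ WAllCornerFTwoInertBad := by
  rw [wAllCornerFTwo_iff_slices, wAllCornerFTwoRamified_iff_tyzProved_offTYZProved]

end Summit.BirchSwinnertonDyer

end
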